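import Summits.HubbardSuperconductivity.HubbardSuperconductivity.Theorems.PbContinuationTwoTilingRay
import Summits.HubbardSuperconductivity.HubbardSuperconductivity.Theorems.CooperPairDMottWalkBreathingAtOneIsPure
import Summits.HubbardSuperconductivity.HubbardSuperconductivity.Theorems.CooperPairDMottWalkBindingWalkSelfDualTransport
import Summits.HubbardSuperconductivity.HubbardSuperconductivity.Theorems.BalabanIRBirEveryGroundStateSchur

/-!
# Crux `PbContinuation` (stmt-HubbardSuperconductivity-0907; = `LevyLogBootstrap.Continuation`,
# `AnisotropyChord.Continuation`, `PolyaSchurPairBoson.Continuation`) — the two-tiling FRUSTRATION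
# closes linearly at the uniform point (sequel of `PbContinuationTwoTilingRay`, restatement-invariant)

`Theorems/PbContinuationTwoTilingRay.lean` (line lead, p158414) proves the two-tiling identity
`H_A(1,t',U) + T H_A(1,t',U) T⁻¹ = hamiltonian G (1+t') (2U)` for the checkerboard Hubbard Hamiltonian
`H_A(a,b,U) = hamiltonian (G ∖ K) a U + hamiltonian (G ⊓ K) b 0` of the crux and the Anderson bound
`2·E(H_A) ≤ E(partner)` in the sectors `(2n, S^z = 0)`, so that every partner ground state is a
low-energy state of `H_A` up to the FRUSTRATION `Γ_L(t',U) := E_{(2n,0)}(hamiltonian G (1+t') (2U)) −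
2·E_{(2n,0)}(H_A(1,t',U)) ≥ 0` (`expect_checkerboard_sub_le_frustration`). This file adds the upper side
of that handle, the only quantitative control of `Γ_L` the ray restatement (STRATEGY-CENSUS §5 R5, card
`two-tiling-ray`: "Γ_L(1) = 0") can cite today:

* `defect_le_of_groundState_left` — generic first-order (variational) bound on an Anderson defect:
  `E_K(A+B) − E_K(A) − E_K(B) ≤ re⟨ψ, Bψ⟩ − E_K(B)` at a unit vector `ψ ∈ K` realising `E_K(A)`;
* `hamiltonian_eq_add_smul_hopping`, `twoHopping_swap_eq_add_smul` — the translated copy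
  `T H_A(1,t',U) T⁻¹ = H_A(t',1,U)` (`relabel_translate_breathing`) is an AFFINE move from `H_A(1,t',U)`:
  `H_A(t',1,U) = H_A(1,t',U) + (1 − t')·(T_inter − T_intra)`, `T_X = hamiltonian X 1 0`;
* `minEnergyOn_relabel_translate_szSector` — sector energies are translation invariant (equality, every
  joint sector `(N, S^z = M)`; the predecessor file has the inequality it needs);
* `frustration_le_firstOrder` / closed form `frustrationFirstOrder` (registered support sub-goal) —
  **`Γ_L(t',U) ≤ (1 − t') · re⟨ψ_A, (T_inter − T_intra) ψ_A⟩`** for every normalised `(2n,0)`-sector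
  ground state `ψ_A` of `H_A(1,t',U)`: the frustration is `O((1−t')·L²)` and closes linearly at `t' = 1`;
* `frustration_one` — `Γ_L(1,U) = 0` (at `t' = 1` the checkerboard Hamiltonian IS `hubbardTorus 2 L 1 U`,
  `CooperPairDMottWalk.hamiltonian_sdiff_add_inf`, and the partner is `2 • hubbardTorus 2 L 1 U`).

Bookkeeping only: it does not bear on the truth of the crux as typed. Folklore finite-dimensional
variational analysis (P. W. Anderson, Phys. Rev. 83 (1951) 1260; Tasaki (2020) §2.1). No definition is
introduced.
-/

noncomputable section

namespace Summit.HubbardSuperconductivity.PbContinuation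

open Matrix
open Literature.MathematicalPhysics.QuantumLattice Literature.Probability.LatticeModels
open Summit.HubbardSuperconductivity.HubbardSuperconductivity.Theorems
open scoped ComplexOrder

/-! ### A generic first-order bound on Anderson defects -/

section Generic

variable {n : Type*} [Fintype n]

/-- **First-order (variational) upper bound on the Anderson defect**: at a unit vector `ψ ∈ K`
realising the sector energy of `A`, `E_K(A+B) − E_K(A) − E_K(B) ≤ re⟨ψ, Bψ⟩ − E_K(B)`
(test `A + B` on `ψ`). [cite: Tasaki2020, §2.1 (variational principle)] -/
theorem defect_le_of_groundState_left (A B : Matrix n n ℂ) (K : Submodule ℂ (n → ℂ)) {ψ : n → ℂ}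
    (hψK : ψ ∈ K) (hψ : star ψ ⬝ᵥ ψ = 1)
    (hground : (star ψ ⬝ᵥ A *ᵥ ψ).re = A.minEnergyOn K) :
    (A + B).minEnergyOn K - A.minEnergyOn K - B.minEnergyOn K ≤
      (star ψ ⬝ᵥ B *ᵥ ψ).re - B.minEnergyOn K := by
  have hAB := minEnergyOn_le_re_rayleigh (A + B) K hψK hψ
  rw [add_mulVec, dotProduct_add, Complex.add_re] at hAB
  linarith

end Generic

/-! ### The hopping swap is an affine move -/

section Linear

variable {Λ : Type*} [LinearOrder Λ] [Fintype Λ]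

/-- Changing the hopping at fixed interaction adds a multiple of the bare hopping operator:
`hamiltonian X b U = hamiltonian X a U + (b − a) • hamiltonian X 1 0`. [folklore] -/
theorem hamiltonian_eq_add_smul_hopping (X : SimpleGraph Λ) [DecidableRel X.Adj] (a b U : ℝ) :
    hamiltonian X b U = hamiltonian X a U + ((b - a : ℝ) : ℂ) • hamiltonian X 1 0 := by
  rw [← hamiltonian_zero_eq_smul X (b - a), hamiltonian_add_hamiltonian_same X]
  congr 1 <;> ring

/-- **Swapping the two hoppings of a two-hopping family is an affine move along `T_X − T_Y`**:
`hamiltonian X b U + hamiltonian Y a 0 = (hamiltonian X a U + hamiltonian Y b 0) + (b − a) • (T_X − T_Y)`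
with `T_Z = hamiltonian Z 1 0`. [folklore] -/
theorem twoHopping_swap_eq_add_smul (X Y : SimpleGraph Λ) [DecidableRel X.Adj] [DecidableRel Y.Adj]
    (a b U : ℝ) :
    hamiltonian X b U + hamiltonian Y a 0 =
      (hamiltonian X a U + hamiltonian Y b 0) +
        ((b - a : ℝ) : ℂ) • (hamiltonian X 1 0 - hamiltonian Y 1 0) := by
  rw [hamiltonian_eq_add_smul_hopping X a b U, hamiltonian_eq_add_smul_hopping Y b a 0,
    show ((a - b : ℝ) : ℂ) = -((b - a : ℝ) : ℂ) by push_cast; ring, smul_sub, neg_smul]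
  abel

end Linear

/-! ### Translation invariance of sector energies -/

section Translate

variable {d L : ℕ} [NeZero L]

/-- **Sector energies are translation invariant**: `E_{(N,M)}(T_v H T_v⁻¹) = E_{(N,M)}(H)` for every
operator `H` on the fermionic torus and every translation `v` (a site bijection;
`minEnergyOn_relabel_szSector`). [cite: BratteliRobinsonII1997, §5.2.2, Thm. 5.2.5] -/
theorem minEnergyOn_relabel_translate_szSector (v : TorusSite d L)
    (H : Matrix (Finset (Orb (FermionTorus d L))) (Finset (Orb (FermionTorus d L))) ℂ) (N : ℕ) (M : ℝ) :
    (relabel (Orb.translate v) H).minEnergyOn (szSector N M) = H.minEnergyOn (szSector N M) :=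
  minEnergyOn_relabel_szSector (FermionTorus.ofTorusEquiv (Equiv.addRight v)) H N M

end Translate

/-! ### The frustration of the two tilings closes linearly at `t' = 1` -/

section Torus

variable {L : ℕ} [NeZero L]

/-- **First-order bound on the frustration**: for every normalised sector ground state `ψ_A` of the
checkerboard Hamiltonian `H_A(1,t',U)` in a joint sector `(N, S^z = M)` (even `L ≥ 4`),
`E(hamiltonian G (1+t') (2U)) − 2·E(H_A(1,t',U)) ≤ (1 − t') · re⟨ψ_A, (T_inter − T_intra) ψ_A⟩`:
the translated copy is `H_A(t',1,U) = H_A(1,t',U) + (1 − t')·(T_inter − T_intra)`, so the variational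
bound `E(H_A + T H_A T⁻¹) ≤ ⟨ψ_A, (H_A + T H_A T⁻¹) ψ_A⟩` closes the frustration linearly as `t' → 1`.
[cite: Tasaki2020, §2.1 (variational principle)] -/
theorem frustration_le_firstOrder (hL : Even L) (h4 : 4 ≤ L) (t' U : ℝ) {N : ℕ} {M : ℝ}
    {ψ : Fock (Orb (FermionTorus 2 L))} (hψ1 : star ψ ⬝ᵥ ψ = 1)
    (hψ : IsGroundStateInSector
      ((hamiltonian (fermionTorusGraph 2 L \ (⊤ : SimpleGraph (Fin 2 → ℕ)).comap
          (fun (x : FermionTorus 2 L) (i : Fin 2) => (ofLex x i : ℕ) / 2)) 1 U +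
        hamiltonian (fermionTorusGraph 2 L ⊓ (⊤ : SimpleGraph (Fin 2 → ℕ)).comap
          (fun (x : FermionTorus 2 L) (i : Fin 2) => (ofLex x i : ℕ) / 2)) t' 0)) N M ψ) :
    (hamiltonian (fermionTorusGraph 2 L) (1 + t') (2 * U)).minEnergyOn (szSector N M) -
        2 * ((hamiltonian (fermionTorusGraph 2 L \ (⊤ : SimpleGraph (Fin 2 → ℕ)).comap
          (fun (x : FermionTorus 2 L) (i : Fin 2) => (ofLex x i : ℕ) / 2)) 1 U +
        hamiltonian (fermionTorusGraph 2 L ⊓ (⊤ : SimpleGraph (Fin 2 → ℕ)).comap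
          (fun (x : FermionTorus 2 L) (i : Fin 2) => (ofLex x i : ℕ) / 2)) t' 0)).minEnergyOn (szSector N M) ≤
      (1 - t') * (expect ((hamiltonian (fermionTorusGraph 2 L ⊓ (⊤ : SimpleGraph (Fin 2 → ℕ)).comap
          (fun (x : FermionTorus 2 L) (i : Fin 2) => (ofLex x i : ℕ) / 2)) 1 0) -
          (hamiltonian (fermionTorusGraph 2 L \ (⊤ : SimpleGraph (Fin 2 → ℕ)).comap
          (fun (x : FermionTorus 2 L) (i : Fin 2) => (ofLex x i : ℕ) / 2)) 1 0)) ψ).re := by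
  set A := (hamiltonian (fermionTorusGraph 2 L \ (⊤ : SimpleGraph (Fin 2 → ℕ)).comap
          (fun (x : FermionTorus 2 L) (i : Fin 2) => (ofLex x i : ℕ) / 2)) 1 U +
        hamiltonian (fermionTorusGraph 2 L ⊓ (⊤ : SimpleGraph (Fin 2 → ℕ)).comap
          (fun (x : FermionTorus 2 L) (i : Fin 2) => (ofLex x i : ℕ) / 2)) t' 0) with hA
  set B := relabel (Orb.translate (fun _ : Fin 2 => (1 : ZMod L))) A with hB
  -- the translated copy is the hopping-swapped Hamiltonian, an affine move from `A`
  have hB' : B = A + ((1 - t' : ℝ) : ℂ) •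
      ((hamiltonian (fermionTorusGraph 2 L ⊓ (⊤ : SimpleGraph (Fin 2 → ℕ)).comap
          (fun (x : FermionTorus 2 L) (i : Fin 2) => (ofLex x i : ℕ) / 2)) 1 0) -
          (hamiltonian (fermionTorusGraph 2 L \ (⊤ : SimpleGraph (Fin 2 → ℕ)).comap
          (fun (x : FermionTorus 2 L) (i : Fin 2) => (ofLex x i : ℕ) / 2)) 1 0)) := by
    rw [hB, hA, relabel_translate_breathing hL h4 1 t' U, twoHopping_swap_eq_add_smul,
      ← neg_sub (hamiltonian (fermionTorusGraph 2 L ⊓ (⊤ : SimpleGraph (Fin 2 → ℕ)).comap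
        (fun (x : FermionTorus 2 L) (i : Fin 2) => (ofLex x i : ℕ) / 2)) 1 0), smul_neg, ← neg_smul]
    congr 2
    push_cast
    ring
  -- sector energies: sum = partner, copy = original
  have hsum : (A + B).minEnergyOn (szSector N M) =
      (hamiltonian (fermionTorusGraph 2 L) (1 + t') (2 * U)).minEnergyOn (szSector N M) := by
    rw [hB, hA, twoTiling_sum hL h4 t' U]
  have hBE : B.minEnergyOn (szSector N M) = A.minEnergyOn (szSector N M) := by
    rw [hB, minEnergyOn_relabel_translate_szSector]
  -- the variational bound at `ψ`
  have hground : (star ψ ⬝ᵥ A *ᵥ ψ).re = A.minEnergyOn (szSector N M) := by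
    have h := expect_eq_sectorEnergy hψ1 hψ
    rw [Literature.MathematicalPhysics.QuantumLattice.expect] at h
    rw [h, Complex.ofReal_re]
  have h := defect_le_of_groundState_left A B (szSector N M) hψ.1 hψ1 hground
  have hexp : (star ψ ⬝ᵥ B *ᵥ ψ).re =
      A.minEnergyOn (szSector N M) + (1 - t') *
        (expect ((hamiltonian (fermionTorusGraph 2 L ⊓ (⊤ : SimpleGraph (Fin 2 → ℕ)).comap
          (fun (x : FermionTorus 2 L) (i : Fin 2) => (ofLex x i : ℕ) / 2)) 1 0) -
          (hamiltonian (fermionTorusGraph 2 L \ (⊤ : SimpleGraph (Fin 2 → ℕ)).comap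
          (fun (x : FermionTorus 2 L) (i : Fin 2) => (ofLex x i : ℕ) / 2)) 1 0)) ψ).re := by
    rw [hB', add_mulVec, dotProduct_add, Complex.add_re, hground, smul_mulVec, dotProduct_smul,
      smul_eq_mul, Complex.re_ofReal_mul, Literature.MathematicalPhysics.QuantumLattice.expect]
  rw [hsum, hBE, hexp] at h
  linarith

omit [NeZero L] in
/-- **The frustration vanishes at the uniform point** (`Γ_L(1,U) = 0`, every joint sector): at
`t' = 1` the checkerboard Hamiltonian IS `hubbardTorus 2 L 1 U = hamiltonian G 1 U` (edge partition
`CooperPairDMottWalk.hamiltonian_sdiff_add_inf`) and the partner `hamiltonian G 2 (2U)` is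
`2 • hamiltonian G 1 U` (`hamiltonian_scale`). [folklore] -/
theorem frustration_one (U : ℝ) (N : ℕ) (M : ℝ) :
    (hamiltonian (fermionTorusGraph 2 L) (1 + 1) (2 * U)).minEnergyOn (szSector N M) -
      2 * ((hamiltonian (fermionTorusGraph 2 L \ (⊤ : SimpleGraph (Fin 2 → ℕ)).comap
          (fun (x : FermionTorus 2 L) (i : Fin 2) => (ofLex x i : ℕ) / 2)) 1 U +
        hamiltonian (fermionTorusGraph 2 L ⊓ (⊤ : SimpleGraph (Fin 2 → ℕ)).comap
          (fun (x : FermionTorus 2 L) (i : Fin 2) => (ofLex x i : ℕ) / 2)) 1 0)).minEnergyOn (szSector N M) = 0 := by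
  rw [CooperPairDMottWalk.hamiltonian_sdiff_add_inf _ _ (1 : ℝ) U, show (1 + 1 : ℝ) = 2 * 1 by norm_num,
    hamiltonian_scale (fermionTorusGraph 2 L) 2 1 U,
    CooperPairDMottWalk.minEnergyOn_real_smul _ _ (by norm_num : (0 : ℝ) ≤ 2)]
  ring

/-- **Registered support sub-goal `frustrationFirstOrder`** (crux item stmt-HubbardSuperconductivity-0907;
closed form of `frustration_le_firstOrder` in the crux's sectors `(2n, S^z = 0)`): for even `L ≥ 4`,
all `t', U`, and every normalised `(2n,0)`-sector ground state `ψ` of the checkerboard Hamiltonian,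
`E(hamiltonian G (1+t') (2U)) − 2·E(H_A(1,t',U)) ≤ (1 − t')·re⟨ψ, (T_inter − T_intra) ψ⟩`. [folklore] -/
theorem frustrationFirstOrder :
    ∀ (L : ℕ) [NeZero L], Even L → 4 ≤ L → ∀ (t' U : ℝ) (n : ℕ) (ψ : Fock (Orb (FermionTorus 2 L))),
      star ψ ⬝ᵥ ψ = 1 →
      IsGroundStateInSector (hamiltonian ((fermionTorusGraph 2 L) \ SimpleGraph.comap
          (fun x : FermionTorus 2 L => fun i : Fin 2 => ((ofLex x) i : ℕ) / 2) ⊤) 1 U +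
        hamiltonian ((fermionTorusGraph 2 L) ⊓ SimpleGraph.comap
          (fun x : FermionTorus 2 L => fun i : Fin 2 => ((ofLex x) i : ℕ) / 2) ⊤) t' 0) (2 * n) 0 ψ →
      (hamiltonian (fermionTorusGraph 2 L) (1 + t') (2 * U)).minEnergyOn (szSector (2 * n) 0) -
          2 * (hamiltonian ((fermionTorusGraph 2 L) \ SimpleGraph.comap
              (fun x : FermionTorus 2 L => fun i : Fin 2 => ((ofLex x) i : ℕ) / 2) ⊤) 1 U +
            hamiltonian ((fermionTorusGraph 2 L) ⊓ SimpleGraph.comap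
              (fun x : FermionTorus 2 L => fun i : Fin 2 => ((ofLex x) i : ℕ) / 2) ⊤) t' 0).minEnergyOn
            (szSector (2 * n) 0) ≤
        (1 - t') * (expect (hamiltonian ((fermionTorusGraph 2 L) ⊓ SimpleGraph.comap
              (fun x : FermionTorus 2 L => fun i : Fin 2 => ((ofLex x) i : ℕ) / 2) ⊤) 1 0 -
            hamiltonian ((fermionTorusGraph 2 L) \ SimpleGraph.comap
              (fun x : FermionTorus 2 L => fun i : Fin 2 => ((ofLex x) i : ℕ) / 2) ⊤) 1 0) ψ).re := by
  intro L _ hL h4 t' U n ψ hψ1 hψ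
  exact frustration_le_firstOrder hL h4 t' U hψ1 hψ

end Torus

end Summit.HubbardSuperconductivity.PbContinuation

end
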